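import Summits.CriticalPhenomena.PercolationContinuityZ3.Theorems.SahiMasterFamilyFaceVanishingPrincipalCap
import Summits.CriticalPhenomena.PercolationContinuityZ3.Theorems.SahiMasterFamilyPrincipalCapBetaSmall

/-!
# The face-vanishing class at EVERY order: Sahi's `C_k` there follows from seat P4's finite conjectures `F(j)`, `j ≤ k`, and pointwise
# (EQ-k) there from comb positivity on principal caps

Unit `prim-master-conj` (crux anchor stmt-CriticalPhenomena-4575, helper work), gen 13; companion of `SahiMasterFamilyFaceVanishingPrincipalCap.lean`
(FVT_k without side conditions, orders four and five).  The assembly there is an induction on the order, written here once and for all: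
for a face-vanishing `k`-family (all minors at the determining set zero flags), `k ≥ 4`, either a member is EMPTY (`E_k = 0`, `Z_k`), or a deleted
sub-family is a ZERO FLAG (the all-order step `masterFamily_step_all`), or a member ABSORBS the others (`E_k = ((k−1) − μ)·E_{k−1}` of the deleted
family, which is again face-vanishing: `faceVanishing_erase_of_absorbing`), or the family is PRINCIPAL-CAP (`GluedFrames.principalCap_of_faceVanishing`).
Hence:

* `sahiE_ind_nonneg_of_faceVanishing_of_phiNonneg` — **law level, every order**: if seat P4's polynomial inequality `PhiNonneg (j+4)` (= F(j+4),
  `SahiMasterFamilyPrincipalCapBeta`; theorems for `j + 4 ≤ 5`, OPEN from `6`) holds for all `j ≤ n`, then **Sahi's `C_{n+4}` holds on every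
  face-vanishing `(n+4)`-family** (P4's `sahiE_ind_nonneg_of_phiNonneg` on the principal caps; order three = P4's `sahiE_three_nonneg_of_faceVanishing`);
  `sahiE_six_ind_nonneg_of_faceVanishing_of_phiNonneg` — the first open instance: `PhiNonneg 6 →` `C₆` on every face-vanishing 6-family.
* `sahiE_ind_eq_zero_iff_of_faceVanishing_of_principalCapComb` — **pointwise, every order**: if principal-cap families of orders `4, …, n+4` are
  comb-positive (stated inline; theorems for orders `4, 5`: `combPos_sahiE_four/five_of_principalCap`), then **at every interior `p`, `E_{n+4}(μ_p; 1_U) = 0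
  ↔ U ∈ Z_{n+4}` for every face-vanishing `(n+4)`-family**.
So on the face-vanishing class the master conjecture at every order is reduced to P4's principal-cap problem (F(k) / its comb form).  HONEST FRAMING: `PhiNonneg k`
for `k ≥ 6`, (M⁺-k) on principal caps for `k ≥ 6`, and everything off the face-vanishing class remain OPEN.  Axioms standard. [this work]
-/

noncomputable section

open scoped Classical

namespace Summit.CriticalPhenomena.PercolationContinuityZ3.Theorems

open Finset Function
open Literature.Combinatorics.Sahi2008
open Literature.Probability.LatticeModels.Kahn2022 (Affects)
open Literature.Probability.Percolation (DeterminedBy)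
open Literature.Probability.Percolation.DecisionTree (ind)
open SahiComb

namespace Pointwise

variable {ι : Type} [Fintype ι]

/-- The absorbing factor `(n + 1) − μ(U_j)` is positive for `n ≥ 1` (indeed `≥ n`). [this work] -/
theorem absorbing_factor_pos (p : ι → unitInterval) (V : Set (Set ι)) (n : ℕ) :
    (0 : ℝ) < ((n + 1 : ℕ) : ℝ) + 1 - ex (bernoulliWeight p) (ind V) := by
  have h1 := ex_bernoulliWeight_ind_le_one p V
  push_cast
  linarith [(Nat.cast_nonneg n : (0 : ℝ) ≤ n)]

/-! ### Law level: `C_k` on the face-vanishing class from `PhiNonneg` -/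

/-- **Sahi's `C_{n+4}` on every face-vanishing `(n+4)`-family, given P4's `PhiNonneg (j+4)` for `j ≤ n`** (induction on the order; see the
module docstring). [this work] -/
theorem sahiE_ind_nonneg_of_faceVanishing_of_phiNonneg :
    ∀ (n : ℕ), (∀ j, j ≤ n → PrincipalCapBeta.PhiNonneg (j + 4)) →
      ∀ (ι : Type) [Fintype ι] (p : ι → unitInterval) (U : Fin (n + 4) → Set (Set ι)) (S : Finset ι),
        (∀ j, IsUpperSet (U j)) → (∀ j, DeterminedBy (U j) (↑S : Set ι)) →
        (∀ e ∈ S, ∀ b : Bool, SuppZeroFlag (n + 4) (fun j => secAt e b (U j))) →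
          0 ≤ sahiE (bernoulliWeight p) (n + 4) (fun j => ind (U j)) := by
  intro n
  induction n with
  | zero =>
    intro hΦ ι _ p U S hU hUS hall
    by_cases habs : ∃ j, ∀ l, l ≠ j → U l ⊆ U j
    · obtain ⟨j, hj⟩ := habs
      rw [sahiE_ind_eq_of_absorbing (bernoulliWeight p) (n := 2) U j hj]
      exact mul_nonneg (absorbing_factor_pos p (U j) 1).le
        (sahiE_three_nonneg_of_faceVanishing ι p (fun i => U (j.succAbove i)) S (fun i => hU _) (fun i => hUS _)
          (faceVanishing_erase_of_absorbing U S hU hall j hj))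
    · push Not at habs
      by_cases hempty : ∃ j, U j = ∅
      · obtain ⟨j, hj⟩ := hempty
        exact (sahiE_ind_eq_zero_of_eq_empty p U j hj).ge
      · by_cases hdel : ∃ m : Fin 4, SuppZeroFlag 3 (fun j => U (m.succAbove j))
        · obtain ⟨m, hm⟩ := hdel
          exact (masterFamily_step_all p U hU m hm).1
        · push Not at hdel
          obtain ⟨hne, h0⟩ := nonempty_and_nonsure_of_noAbsorber U hU hdel habs
          obtain ⟨c, hcap⟩ := GluedFrames.principalCap_of_faceVanishing 0 ι U S hU hUS hne h0 hdel hall habs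
          exact PrincipalCapBeta.sahiE_ind_nonneg_of_phiNonneg (hΦ 0 le_rfl) p U hU c hcap
  | succ n ih =>
    intro hΦ ι _ p U S hU hUS hall
    have ih' := ih (fun j hj => hΦ j (Nat.le_succ_of_le hj))
    by_cases habs : ∃ j, ∀ l, l ≠ j → U l ⊆ U j
    · obtain ⟨j, hj⟩ := habs
      rw [sahiE_ind_eq_of_absorbing (bernoulliWeight p) (n := n + 3) U j hj]
      exact mul_nonneg (absorbing_factor_pos p (U j) (n + 2)).le
        (ih' ι p (fun i => U (j.succAbove i)) S (fun i => hU _) (fun i => hUS _)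
          (faceVanishing_erase_of_absorbing U S hU hall j hj))
    · push Not at habs
      by_cases hempty : ∃ j, U j = ∅
      · obtain ⟨j, hj⟩ := hempty
        exact (sahiE_ind_eq_zero_of_eq_empty p U j hj).ge
      · by_cases hdel : ∃ m : Fin (n + 1 + 4), SuppZeroFlag (n + 1 + 3) (fun j => U (m.succAbove j))
        · obtain ⟨m, hm⟩ := hdel
          exact (masterFamily_step_all p U hU m hm).1
        · push Not at hdel
          obtain ⟨hne, h0⟩ := nonempty_and_nonsure_of_noAbsorber U hU hdel habs
          obtain ⟨c, hcap⟩ := GluedFrames.principalCap_of_faceVanishing (n + 1) ι U S hU hUS hne h0 hdel hall habs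
          exact PrincipalCapBeta.sahiE_ind_nonneg_of_phiNonneg (hΦ (n + 1) le_rfl) p U hU c hcap

/-- **The first open instance: `PhiNonneg 6 → C₆` on every face-vanishing 6-family** (orders four and five of `PhiNonneg` being P4's theorems
`phiNonneg_four`, `phiNonneg_five`). [this work] -/
theorem sahiE_six_ind_nonneg_of_faceVanishing_of_phiNonneg (h6 : PrincipalCapBeta.PhiNonneg 6) (p : ι → unitInterval)
    (U : Fin 6 → Set (Set ι)) (S : Finset ι) (hU : ∀ j, IsUpperSet (U j)) (hUS : ∀ j, DeterminedBy (U j) (↑S : Set ι))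
    (hall : ∀ e ∈ S, ∀ b : Bool, SuppZeroFlag 6 (fun j => secAt e b (U j))) :
    0 ≤ sahiE (bernoulliWeight p) 6 (fun j => ind (U j)) := by
  refine sahiE_ind_nonneg_of_faceVanishing_of_phiNonneg 2 (fun j hj => ?_) ι p U S hU hUS hall
  interval_cases j
  · exact PrincipalCapBeta.phiNonneg_four
  · exact PrincipalCapBeta.phiNonneg_five
  · exact h6

/-! ### Pointwise: (EQ-k) on the face-vanishing class from comb positivity on principal caps -/

/-- **Pointwise (EQ-(n+4)) on every face-vanishing `(n+4)`-family, given comb positivity of principal-cap families of orders `4, …, n+4`**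
(the hypothesis is a theorem for orders four and five: `combPos_sahiE_four_of_principalCap`, `combPos_sahiE_five_of_principalCap`). [this work] -/
theorem sahiE_ind_eq_zero_iff_of_faceVanishing_of_principalCapComb :
    ∀ (n : ℕ), (∀ j, j ≤ n → ∀ (ι : Type) [Fintype ι] (V : Fin (j + 4) → Set (Set ι)), (∀ i, IsUpperSet (V i)) →
        ∀ c : Finset ι, (∀ T : Set ι, (∀ i, T ∈ V i) ↔ (↑c : Set ι) ⊆ T) →
          CombPos (fun _ : ι => j + 4) (fun q => sahiE (bernoulliWeight q) (j + 4) (fun i => ind (V i)))) →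
      ∀ (ι : Type) [Fintype ι] (p : ι → unitInterval), (∀ e, (p e : ℝ) ∈ Set.Ioo (0 : ℝ) 1) →
        ∀ (U : Fin (n + 4) → Set (Set ι)) (S : Finset ι), (∀ j, IsUpperSet (U j)) → (∀ j, DeterminedBy (U j) (↑S : Set ι)) →
        (∀ e ∈ S, ∀ b : Bool, SuppZeroFlag (n + 4) (fun j => secAt e b (U j))) →
          (sahiE (bernoulliWeight p) (n + 4) (fun j => ind (U j)) = 0 ↔ SuppZeroFlag (n + 4) U) := by
  intro n
  induction n with
  | zero =>
    intro hPC ι _ p hp U S hU hUS hall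
    refine ⟨fun hz => ?_, fun hZ => masterFamilyEqIff_mpr 4 ι p U hZ⟩
    by_cases habs : ∃ j, ∀ l, l ≠ j → U l ⊆ U j
    · obtain ⟨j, hj⟩ := habs
      rw [sahiE_ind_eq_of_absorbing (bernoulliWeight p) (n := 2) U j hj] at hz
      have hE : sahiE (bernoulliWeight p) 3 (fun i => ind (U (j.succAbove i))) = 0 :=
        (mul_eq_zero.1 hz).resolve_left (absorbing_factor_pos p (U j) 1).ne'
      exact (suppZeroFlag_iff_erase_of_absorbing U hU j hj).2
        ((sahiE_three_ind_eq_zero_iff_of_faceVanishing ι p hp (fun i => U (j.succAbove i)) S (fun i => hU _) (fun i => hUS _)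
          (faceVanishing_erase_of_absorbing U S hU hall j hj)).1 hE)
    · push Not at habs
      by_cases hdel : ∃ m : Fin 4, SuppZeroFlag 3 (fun j => U (m.succAbove j))
      · obtain ⟨m, hm⟩ := hdel
        exact ((masterFamily_step_all p U hU m hm).2 hp).1 hz
      · push Not at hdel
        obtain ⟨hne, h0⟩ := nonempty_and_nonsure_of_noAbsorber U hU hdel habs
        obtain ⟨c, hcap⟩ := GluedFrames.principalCap_of_faceVanishing 0 ι U S hU hUS hne h0 hdel hall habs
        exact (sahiE_ind_eq_zero_iff_of_combPos hU (hPC 0 le_rfl ι U hU c hcap) hp).1 hz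
  | succ n ih =>
    intro hPC ι _ p hp U S hU hUS hall
    have ih' := ih (fun j hj => hPC j (Nat.le_succ_of_le hj))
    refine ⟨fun hz => ?_, fun hZ => masterFamilyEqIff_mpr _ ι p U hZ⟩
    by_cases habs : ∃ j, ∀ l, l ≠ j → U l ⊆ U j
    · obtain ⟨j, hj⟩ := habs
      rw [sahiE_ind_eq_of_absorbing (bernoulliWeight p) (n := n + 3) U j hj] at hz
      have hE : sahiE (bernoulliWeight p) (n + 4) (fun i => ind (U (j.succAbove i))) = 0 :=
        (mul_eq_zero.1 hz).resolve_left (absorbing_factor_pos p (U j) (n + 2)).ne'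
      exact (suppZeroFlag_iff_erase_of_absorbing U hU j hj).2
        ((ih' ι p hp (fun i => U (j.succAbove i)) S (fun i => hU _) (fun i => hUS _)
          (faceVanishing_erase_of_absorbing U S hU hall j hj)).1 hE)
    · push Not at habs
      by_cases hdel : ∃ m : Fin (n + 1 + 4), SuppZeroFlag (n + 1 + 3) (fun j => U (m.succAbove j))
      · obtain ⟨m, hm⟩ := hdel
        exact ((masterFamily_step_all p U hU m hm).2 hp).1 hz
      · push Not at hdel
        obtain ⟨hne, h0⟩ := nonempty_and_nonsure_of_noAbsorber U hU hdel habs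
        obtain ⟨c, hcap⟩ := GluedFrames.principalCap_of_faceVanishing (n + 1) ι U S hU hUS hne h0 hdel hall habs
        exact (sahiE_ind_eq_zero_iff_of_combPos hU (hPC (n + 1) le_rfl ι U hU c hcap) hp).1 hz

end Pointwise

end Summit.CriticalPhenomena.PercolationContinuityZ3.Theorems
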